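import Summits.ValiantsHypothesis.ValiantsHypothesis.Theorems.GrenetZeonDualUnipotentThreeHalvesHeavyTopInstFourSevenBlocks

/-!
# `GrenetZeon.DualUnipotentThreeHalves` (stmt-ValiantsHypothesis-24318) — successor line `slow_core`, the format `(4,7)` in POWER currency:
# helper B — the BUDGET-ONE DECISION TREE of ✓ `no_wordTame_one_NSeven` re-plumbed to the hypotheses power currency supplies

Experiment cell «val-heavytop-census» (D-0160), engine seat val-htc-eng-1 g2 (kernel-only lane, director-valiant g17 R315 (4)).
Part of the chain `…SlowFourSeven{Square, Cube, Line}` → `…/Negative/SlowFourSeven` (`¬ Slow 4 7 NSeven`: the `(4,7)` cell of the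
census grid is ✗ in the successor head currency R2ᵖ `HeavyTopSlowLaw` too, unconditionally).

In power currency with budget `k = 1` a direction space `K` (`dim K ≥ 9`) makes every entry of `(Q(x) + s·Q(v))³`, `v ∈ K`, of
`s`-degree `≤ 1` (`Q = topSeven`).  The `s²`-coefficient `Q(x)Q(v)² + Q(v)Q(x)Q(v) + Q(v)²Q(x) = 0` (all tops `Q(x)`) yields — see
`…SlowFourSevenLine` — the SAME two inputs the word-currency tree of ✓ `no_wordTame_one_NSeven` (val-port-2 g2, ✓
`…HeavyTopInstFourSevenBudgetOne`) consumes: the pivot identities `Q(v)·P·Q(v) = 0` for every top `P` (so ✓ `budgetOne_blocks`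
applies verbatim) and the four square relations at the entries `(0,3), (0,4), (0,5), (1,4)` of `Q(v)²` (✓ `budgetOne_squares` itself
needs `Q(v)² = 0`, which power currency does NOT give: `Q(v)² = λ·E₀₆` is allowed, e.g. `v = e₀₃ + e₃₆`).  THIS FILE is that tree with
the four relations taken as hypotheses:

* `no_squareCorner_NSeven` — `dim K > 8`, `Q(v)PQ(v) = 0` for all tops `P`, and the four square relations ⇒ `False`
  (sixteen leaves, each with `≥ 8` dead coordinates; proof text = ✓ `no_wordTame_one_NSeven`'s decision tree, verbatim, credited).

Honest framing: bookkeeping for ONE tiny format in the successor currency (`--supports stmt-ValiantsHypothesis-24318 --as helper`);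
nothing here asserts or refutes R2ᵖ `HeavyTopSlowLaw`, S3, IRR/RED, the crux, 8062 or `VP ≠ VNP` — all OPEN / NOT proved.
[✓ `…HeavyTopInstFourSevenBudgetOne` (val-port-2 g2); ✓ `…HeavyTopInstFourSevenBlocks`; this seat]
-/

set_option linter.dupNamespace false
set_option autoImplicit false

noncomputable section

namespace Summit.ValiantsHypothesis.ValiantsHypothesis.Theorems.GrenetZeon.SlowFourSeven

open MvPolynomial Matrix
open scoped BigOperators
open Summit.ValiantsHypothesis.ValiantsHypothesis.Theorems.GrenetZeon.RadicalSplit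

/-- **The budget-one tree in power currency**: no direction space `K` of dimension `> 8` has `Q(v)·P·Q(v) = 0` for all tops `P` and
the four square relations at the entries `(0,3), (0,4), (0,5), (1,4)` of `Q(v)²`, `v ∈ K` (`Q = topSeven`).  Seven pivot dichotomies
(✓ `budgetOne_blocks`) and sixteen leaves, each with `≥ 8` dead coordinates. [tree verbatim from ✓ `no_wordTame_one_NSeven`, val-port-2 g2] -/
theorem no_squareCorner_NSeven (K : Submodule ℂ (Fin 4 × Fin 4 → ℂ)) (hdim : 8 < Module.finrank ℂ K)
    (hqpq : ∀ x : Fin 4 × Fin 4 → ℂ, ∀ v ∈ K, topSeven v * topSeven x * topSeven v = 0)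
    (sq14 : ∀ v ∈ K, v (0,0) * v (1,1) + v (0,1) * v (2,0) = 0)
    (sq15 : ∀ v ∈ K, v (0,0) * v (1,2) + v (0,1) * v (2,1) + v (0,2) * v (3,0) = 0)
    (sq16 : ∀ v ∈ K, v (0,1) * v (2,2) + v (0,2) * v (3,1) + v (0,3) * v (1,3) = 0)
    (sq25 : ∀ v ∈ K, v (1,0) * v (2,1) + v (1,1) * v (3,0) = 0) : False := by
  classical
  have hcard : Fintype.card (Fin 4 × Fin 4) = 16 := by simp
  obtain ⟨blk23, blk24, blk34, blk35, blk45, blk46, blk56⟩ := budgetOne_blocks K hqpq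
  -- the decision tree (16 leaves)
  rcases blk34 with hC | hR
  · have dy1 : ∀ v ∈ K, v (0,1) = 0 := by simpa using hC 0
    have dx2 : ∀ v ∈ K, v (1,0) = 0 := by simpa using hC 1
    rcases blk45 with hC | hR
    · have dz1 : ∀ v ∈ K, v (0,2) = 0 := by simpa using hC 0
      have dy2 : ∀ v ∈ K, v (1,1) = 0 := by simpa using hC 1
      have dx3 : ∀ v ∈ K, v (2,0) = 0 := by simpa using hC 2
      rcases blk56 with hC | hR
      · have dw1 : ∀ v ∈ K, v (0,3) = 0 := by simpa using hC 0
        have dz2 : ∀ v ∈ K, v (1,2) = 0 := by simpa using hC 1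
        have dy3 : ∀ v ∈ K, v (2,1) = 0 := by simpa using hC 2
        have dx4 : ∀ v ∈ K, v (3,0) = 0 := by simpa using hC 3
        have hle := finrank_add_length_le_of_forall_apply_eq_zero K [(0,1), (0,2), (0,3), (1,0), (1,1), (1,2), (2,0), (2,1), (3,0)] (by decide) (by
          intro v hv c hc
          simp only [List.mem_cons, List.mem_nil_iff, or_false] at hc
          rcases hc with rfl | rfl | rfl | rfl | rfl | rfl | rfl | rfl | rfl
          · exact dy1 v hv
          · exact dz1 v hv
          · exact dw1 v hv
          · exact dx2 v hv
          · exact dy2 v hv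
          · exact dz2 v hv
          · exact dx3 v hv
          · exact dy3 v hv
          · exact dx4 v hv
          )
        simp only [List.length_cons, List.length_nil] at hle
        omega
      · have dx6 : ∀ v ∈ K, v (3,3) = 0 := by simpa using hR 0
        rcases blk24 with hC | hR
        · have dx1 : ∀ v ∈ K, v (0,0) = 0 := by simpa using hC 0
          have hp : ∀ v ∈ K, v (0,3) * v (1,3) = 0 := fun v hv => by
            have h := sq16 v hv
            rw [dy1 v hv, dz1 v hv] at h
            simpa using h
          rcases forall_apply_eq_zero_or K (0,3) (1,3) hp with dw1 | dx5
          · have hle := finrank_add_length_le_of_forall_apply_eq_zero K [(0,0), (0,1), (0,2), (0,3), (1,0), (1,1), (2,0), (3,3)] (by decide) (by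
              intro v hv c hc
              simp only [List.mem_cons, List.mem_nil_iff, or_false] at hc
              rcases hc with rfl | rfl | rfl | rfl | rfl | rfl | rfl | rfl
              · exact dx1 v hv
              · exact dy1 v hv
              · exact dz1 v hv
              · exact dw1 v hv
              · exact dx2 v hv
              · exact dy2 v hv
              · exact dx3 v hv
              · exact dx6 v hv
              )
            simp only [List.length_cons, List.length_nil] at hle
            omega
          · have hle := finrank_add_length_le_of_forall_apply_eq_zero K [(0,0), (0,1), (0,2), (1,0), (1,1), (1,3), (2,0), (3,3)] (by decide) (by
              intro v hv c hc
              simp only [List.mem_cons, List.mem_nil_iff, or_false] at hc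
              rcases hc with rfl | rfl | rfl | rfl | rfl | rfl | rfl | rfl
              · exact dx1 v hv
              · exact dy1 v hv
              · exact dz1 v hv
              · exact dx2 v hv
              · exact dy2 v hv
              · exact dx5 v hv
              · exact dx3 v hv
              · exact dx6 v hv
              )
            simp only [List.length_cons, List.length_nil] at hle
            omega
        · have dx4 : ∀ v ∈ K, v (3,0) = 0 := by simpa using hR 0
          have dy4 : ∀ v ∈ K, v (3,1) = 0 := by simpa using hR 1
          have dz4 : ∀ v ∈ K, v (3,2) = 0 := by simpa using hR 2
          have hle := finrank_add_length_le_of_forall_apply_eq_zero K [(0,1), (0,2), (1,0), (1,1), (2,0), (3,0), (3,1), (3,2), (3,3)] (by decide) (by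
            intro v hv c hc
            simp only [List.mem_cons, List.mem_nil_iff, or_false] at hc
            rcases hc with rfl | rfl | rfl | rfl | rfl | rfl | rfl | rfl | rfl
            · exact dy1 v hv
            · exact dz1 v hv
            · exact dx2 v hv
            · exact dy2 v hv
            · exact dx3 v hv
            · exact dx4 v hv
            · exact dy4 v hv
            · exact dz4 v hv
            · exact dx6 v hv
            )
          simp only [List.length_cons, List.length_nil] at hle
          omega
    · have dx5 : ∀ v ∈ K, v (1,3) = 0 := by simpa using hR 0
      have dy5 : ∀ v ∈ K, v (2,3) = 0 := by simpa using hR 1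
      rcases blk56 with hC | hR
      · have dw1 : ∀ v ∈ K, v (0,3) = 0 := by simpa using hC 0
        have dz2 : ∀ v ∈ K, v (1,2) = 0 := by simpa using hC 1
        have dy3 : ∀ v ∈ K, v (2,1) = 0 := by simpa using hC 2
        have dx4 : ∀ v ∈ K, v (3,0) = 0 := by simpa using hC 3
        have hle := finrank_add_length_le_of_forall_apply_eq_zero K [(0,1), (0,3), (1,0), (1,2), (1,3), (2,1), (2,3), (3,0)] (by decide) (by
          intro v hv c hc
          simp only [List.mem_cons, List.mem_nil_iff, or_false] at hc
          rcases hc with rfl | rfl | rfl | rfl | rfl | rfl | rfl | rfl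
          · exact dy1 v hv
          · exact dw1 v hv
          · exact dx2 v hv
          · exact dz2 v hv
          · exact dx5 v hv
          · exact dy3 v hv
          · exact dy5 v hv
          · exact dx4 v hv
          )
        simp only [List.length_cons, List.length_nil] at hle
        omega
      · have dx6 : ∀ v ∈ K, v (3,3) = 0 := by simpa using hR 0
        rcases blk23 with hC | hR
        · have dx1 : ∀ v ∈ K, v (0,0) = 0 := by simpa using hC 0
          have hp : ∀ v ∈ K, v (0,2) * v (3,0) = 0 := fun v hv => by
            have h := sq15 v hv
            rw [dx1 v hv, dy1 v hv] at h
            simpa using h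
          rcases forall_apply_eq_zero_or K (0,2) (3,0) hp with dz1 | dx4
          · have hp : ∀ v ∈ K, v (1,1) * v (3,0) = 0 := fun v hv => by
              have h := sq25 v hv
              rw [dx2 v hv] at h
              simpa using h
            rcases forall_apply_eq_zero_or K (1,1) (3,0) hp with dy2 | dx4
            · have hle := finrank_add_length_le_of_forall_apply_eq_zero K [(0,0), (0,1), (0,2), (1,0), (1,1), (1,3), (2,3), (3,3)] (by decide) (by
                intro v hv c hc
                simp only [List.mem_cons, List.mem_nil_iff, or_false] at hc
                rcases hc with rfl | rfl | rfl | rfl | rfl | rfl | rfl | rfl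
                · exact dx1 v hv
                · exact dy1 v hv
                · exact dz1 v hv
                · exact dx2 v hv
                · exact dy2 v hv
                · exact dx5 v hv
                · exact dy5 v hv
                · exact dx6 v hv
                )
              simp only [List.length_cons, List.length_nil] at hle
              omega
            · have hle := finrank_add_length_le_of_forall_apply_eq_zero K [(0,0), (0,1), (0,2), (1,0), (1,3), (2,3), (3,0), (3,3)] (by decide) (by
                intro v hv c hc
                simp only [List.mem_cons, List.mem_nil_iff, or_false] at hc
                rcases hc with rfl | rfl | rfl | rfl | rfl | rfl | rfl | rfl
                · exact dx1 v hv
                · exact dy1 v hv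
                · exact dz1 v hv
                · exact dx2 v hv
                · exact dx5 v hv
                · exact dy5 v hv
                · exact dx4 v hv
                · exact dx6 v hv
                )
              simp only [List.length_cons, List.length_nil] at hle
              omega
          · have hp : ∀ v ∈ K, v (0,2) * v (3,1) = 0 := fun v hv => by
              have h := sq16 v hv
              rw [dy1 v hv, dx5 v hv] at h
              simpa using h
            rcases forall_apply_eq_zero_or K (0,2) (3,1) hp with dz1 | dy4
            · have hle := finrank_add_length_le_of_forall_apply_eq_zero K [(0,0), (0,1), (0,2), (1,0), (1,3), (2,3), (3,0), (3,3)] (by decide) (by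
                intro v hv c hc
                simp only [List.mem_cons, List.mem_nil_iff, or_false] at hc
                rcases hc with rfl | rfl | rfl | rfl | rfl | rfl | rfl | rfl
                · exact dx1 v hv
                · exact dy1 v hv
                · exact dz1 v hv
                · exact dx2 v hv
                · exact dx5 v hv
                · exact dy5 v hv
                · exact dx4 v hv
                · exact dx6 v hv
                )
              simp only [List.length_cons, List.length_nil] at hle
              omega
            · have hle := finrank_add_length_le_of_forall_apply_eq_zero K [(0,0), (0,1), (1,0), (1,3), (2,3), (3,0), (3,1), (3,3)] (by decide) (by
                intro v hv c hc
                simp only [List.mem_cons, List.mem_nil_iff, or_false] at hc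
                rcases hc with rfl | rfl | rfl | rfl | rfl | rfl | rfl | rfl
                · exact dx1 v hv
                · exact dy1 v hv
                · exact dx2 v hv
                · exact dx5 v hv
                · exact dy5 v hv
                · exact dx4 v hv
                · exact dy4 v hv
                · exact dx6 v hv
                )
              simp only [List.length_cons, List.length_nil] at hle
              omega
        · have dx3 : ∀ v ∈ K, v (2,0) = 0 := by simpa using hR 0
          have dy3 : ∀ v ∈ K, v (2,1) = 0 := by simpa using hR 1
          have dz3 : ∀ v ∈ K, v (2,2) = 0 := by simpa using hR 2
          have hle := finrank_add_length_le_of_forall_apply_eq_zero K [(0,1), (1,0), (1,3), (2,0), (2,1), (2,2), (2,3), (3,3)] (by decide) (by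
            intro v hv c hc
            simp only [List.mem_cons, List.mem_nil_iff, or_false] at hc
            rcases hc with rfl | rfl | rfl | rfl | rfl | rfl | rfl | rfl
            · exact dy1 v hv
            · exact dx2 v hv
            · exact dx5 v hv
            · exact dx3 v hv
            · exact dy3 v hv
            · exact dz3 v hv
            · exact dy5 v hv
            · exact dx6 v hv
            )
          simp only [List.length_cons, List.length_nil] at hle
          omega
  · have dx4 : ∀ v ∈ K, v (3,0) = 0 := by simpa using hR 0
    have dy4 : ∀ v ∈ K, v (3,1) = 0 := by simpa using hR 1
    have dz4 : ∀ v ∈ K, v (3,2) = 0 := by simpa using hR 2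
    rcases blk45 with hC | hR
    · have dz1 : ∀ v ∈ K, v (0,2) = 0 := by simpa using hC 0
      have dy2 : ∀ v ∈ K, v (1,1) = 0 := by simpa using hC 1
      have dx3 : ∀ v ∈ K, v (2,0) = 0 := by simpa using hC 2
      rcases blk35 with hC | hR
      · have dy1 : ∀ v ∈ K, v (0,1) = 0 := by simpa using hC 0
        have dx2 : ∀ v ∈ K, v (1,0) = 0 := by simpa using hC 1
        have hle := finrank_add_length_le_of_forall_apply_eq_zero K [(0,1), (0,2), (1,0), (1,1), (2,0), (3,0), (3,1), (3,2)] (by decide) (by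
          intro v hv c hc
          simp only [List.mem_cons, List.mem_nil_iff, or_false] at hc
          rcases hc with rfl | rfl | rfl | rfl | rfl | rfl | rfl | rfl
          · exact dy1 v hv
          · exact dz1 v hv
          · exact dx2 v hv
          · exact dy2 v hv
          · exact dx3 v hv
          · exact dx4 v hv
          · exact dy4 v hv
          · exact dz4 v hv
          )
        simp only [List.length_cons, List.length_nil] at hle
        omega
      · have dx5 : ∀ v ∈ K, v (1,3) = 0 := by simpa using hR 0
        have dy5 : ∀ v ∈ K, v (2,3) = 0 := by simpa using hR 1
        have hle := finrank_add_length_le_of_forall_apply_eq_zero K [(0,2), (1,1), (1,3), (2,0), (2,3), (3,0), (3,1), (3,2)] (by decide) (by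
          intro v hv c hc
          simp only [List.mem_cons, List.mem_nil_iff, or_false] at hc
          rcases hc with rfl | rfl | rfl | rfl | rfl | rfl | rfl | rfl
          · exact dz1 v hv
          · exact dy2 v hv
          · exact dx5 v hv
          · exact dx3 v hv
          · exact dy5 v hv
          · exact dx4 v hv
          · exact dy4 v hv
          · exact dz4 v hv
          )
        simp only [List.length_cons, List.length_nil] at hle
        omega
    · have dx5 : ∀ v ∈ K, v (1,3) = 0 := by simpa using hR 0
      have dy5 : ∀ v ∈ K, v (2,3) = 0 := by simpa using hR 1
      rcases blk23 with hC | hR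
      · have dx1 : ∀ v ∈ K, v (0,0) = 0 := by simpa using hC 0
        rcases blk46 with hC | hR
        · have dz1 : ∀ v ∈ K, v (0,2) = 0 := by simpa using hC 0
          have dy2 : ∀ v ∈ K, v (1,1) = 0 := by simpa using hC 1
          have dx3 : ∀ v ∈ K, v (2,0) = 0 := by simpa using hC 2
          have hle := finrank_add_length_le_of_forall_apply_eq_zero K [(0,0), (0,2), (1,1), (1,3), (2,0), (2,3), (3,0), (3,1), (3,2)] (by decide) (by
            intro v hv c hc
            simp only [List.mem_cons, List.mem_nil_iff, or_false] at hc
            rcases hc with rfl | rfl | rfl | rfl | rfl | rfl | rfl | rfl | rfl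
            · exact dx1 v hv
            · exact dz1 v hv
            · exact dy2 v hv
            · exact dx5 v hv
            · exact dx3 v hv
            · exact dy5 v hv
            · exact dx4 v hv
            · exact dy4 v hv
            · exact dz4 v hv
            )
          simp only [List.length_cons, List.length_nil] at hle
          omega
        · have dx6 : ∀ v ∈ K, v (3,3) = 0 := by simpa using hR 0
          have hp : ∀ v ∈ K, v (0,1) * v (2,0) = 0 := fun v hv => by
            have h := sq14 v hv
            rw [dx1 v hv] at h
            simpa using h
          rcases forall_apply_eq_zero_or K (0,1) (2,0) hp with dy1 | dx3
          · have hle := finrank_add_length_le_of_forall_apply_eq_zero K [(0,0), (0,1), (1,3), (2,3), (3,0), (3,1), (3,2), (3,3)] (by decide) (by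
              intro v hv c hc
              simp only [List.mem_cons, List.mem_nil_iff, or_false] at hc
              rcases hc with rfl | rfl | rfl | rfl | rfl | rfl | rfl | rfl
              · exact dx1 v hv
              · exact dy1 v hv
              · exact dx5 v hv
              · exact dy5 v hv
              · exact dx4 v hv
              · exact dy4 v hv
              · exact dz4 v hv
              · exact dx6 v hv
              )
            simp only [List.length_cons, List.length_nil] at hle
            omega
          · have hle := finrank_add_length_le_of_forall_apply_eq_zero K [(0,0), (1,3), (2,0), (2,3), (3,0), (3,1), (3,2), (3,3)] (by decide) (by
              intro v hv c hc
              simp only [List.mem_cons, List.mem_nil_iff, or_false] at hc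
              rcases hc with rfl | rfl | rfl | rfl | rfl | rfl | rfl | rfl
              · exact dx1 v hv
              · exact dx5 v hv
              · exact dx3 v hv
              · exact dy5 v hv
              · exact dx4 v hv
              · exact dy4 v hv
              · exact dz4 v hv
              · exact dx6 v hv
              )
            simp only [List.length_cons, List.length_nil] at hle
            omega
      · have dx3 : ∀ v ∈ K, v (2,0) = 0 := by simpa using hR 0
        have dy3 : ∀ v ∈ K, v (2,1) = 0 := by simpa using hR 1
        have dz3 : ∀ v ∈ K, v (2,2) = 0 := by simpa using hR 2
        have hle := finrank_add_length_le_of_forall_apply_eq_zero K [(1,3), (2,0), (2,1), (2,2), (2,3), (3,0), (3,1), (3,2)] (by decide) (by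
          intro v hv c hc
          simp only [List.mem_cons, List.mem_nil_iff, or_false] at hc
          rcases hc with rfl | rfl | rfl | rfl | rfl | rfl | rfl | rfl
          · exact dx5 v hv
          · exact dx3 v hv
          · exact dy3 v hv
          · exact dz3 v hv
          · exact dy5 v hv
          · exact dx4 v hv
          · exact dy4 v hv
          · exact dz4 v hv
          )
        simp only [List.length_cons, List.length_nil] at hle
        omega

end Summit.ValiantsHypothesis.ValiantsHypothesis.Theorems.GrenetZeon.SlowFourSeven

end
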